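import Summits.CriticalPhenomena.PercolationContinuityZ3.Theorems.PercNearOneGluingNoHeavyLowerTailSahiCoSunflowerPrivateCoordinate
import Mathlib.Tactic.Linarith
import Mathlib.Tactic.Ring
import HarnessLib

/-!
# `NoHeavyLowerTail` (crux stmt-CriticalPhenomena-4575), master-family line P1: Sahi's `C_3` on the co-sunflower class when one
# generator is a CYLINDER EVENT of any size (equivalently: Kahn's Conjecture 5 on the complements of the sunflower
# `(F₂ ∩ C, F₁ ∩ C, F₁ ∩ F₂)`, `C = {S ⊆ ω}`) — THEOREM for every product weight and all increasing `F₁, F₂`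

Support file (seat `prim-masterthm-p1`, gen 8; `--supports stmt-CriticalPhenomena-4575`).  No definition, no `sorry`, standard axioms.
Memo `run/shared/lean/prim/prim-masterthm/FROM-prim-masterthm-p1-g8-PRIVATE-COORDINATE.md` §3.

Gen 7 (`…SahiCoSunflowerOrCoordinate`) proved the case `|S| = 1` by a one-coordinate identity and recorded the general cylinder as a paper
statement.  THIS FILE proves it for every `S`, through the closed form of Sahi's functional on sunflower complements in the
"pairwise-intersection" variables and Blinovsky's conditional Harris inequality on a cylinder (`condHarris_ex_ind_cylinder`):

* `sahiE_three_complPairInter_eq` — for ANY three events, with `a = m(F₁F₂F₃)`, `v₁ = m(F₂F₃)`, `v₂ = m(F₁F₃)`, `c = m(F₁F₂)`: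
    `E_3(μ_p; 1_{(F₂F₃)ᶜ}, 1_{(F₁F₃)ᶜ}, 1_{(F₁F₂)ᶜ}) = (1 + c)(a − v₁v₂) − (c − a)(v₁ + v₂)`
  (equivalently `(1+a)(1 + v₁ + v₂ + c) − (1+v₁)(1+v₂)(1+c)`; with `F₃ = univ` it is `(1 + c)·Cov(F₁,F₂)`: the statement CONTAINS Harris);
* `complPairInter_arith` — the arithmetic: `v₁v₂ ≤ π a`, `v₁ + v₂ ≤ π + a`, `π c ≤ a ≤ c ≤ 1` give `(1+c)(a − v₁v₂) − (c−a)(v₁+v₂) ≥ (1+a)(a − πc) ≥ 0`;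
* **`sahiE_three_complPairInter_nonneg_of_condHarris`** — hence `E_3 ≥ 0` whenever `F₁, F₂, F₃` are increasing and `F₃` is CONDITIONALLY
  POSITIVELY CORRELATING for `(F₁, F₂)`: `m(F₁F₃)·m(F₂F₃) ≤ m(F₃)·m(F₁F₂F₃)` (`π = m(F₃)`; Harris gives `πc ≤ a`, inclusion–exclusion inside `F₃`
  gives `v₁ + v₂ ≤ π + a`);
* **`sahiE_three_complPairInter_cylinder_nonneg`** / `sahiE3_compl_sunflower_cylinder_nonneg` — the cylinder `F₃ = {ω | S ⊆ ω}` is such an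
  event for every increasing pair (Blinovsky), so `0 ≤ E_3(μ_p; (F₂ ∩ C)ᶜ, (F₁ ∩ C)ᶜ, (F₁ ∩ F₂)ᶜ)` for all increasing `F₁, F₂`, every `S`, every `p`
  (gen 7's `sahiE3_compl_sunflower_coord_nonneg` is `S = {e}`);
* `sahiE_three_orCylinder_nonneg` — the reflected co-sunflower form: `0 ≤ E_3(μ_p; B ∪ O_S, A ∪ O_S, A ∪ B)` for all increasing `A, B`, where
  `O_S = {ω | ¬ S ⊆ ωᶜ}` ("some coordinate of `S` is open"), generalising gen 7's `sahiE_three_orCoord_nonneg` (`O_{e} = {e ∈ ω}`).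
Why cylinders exactly: `1_C·μ_p` is log-supermodular iff the increasing `C` is closed under `∩`, i.e. a principal filter; for other `F₃` the
conditional correlation can be negative and the slack `(1+a)(a − πc)` must absorb it — that is the open class law.
HONEST FRAMING: a proved stratum (one generator a cylinder of any size, the other two arbitrary increasing); the class and Kahn's
Conjecture 5 remain OPEN. [this work]
-/

noncomputable section

open scoped Classical

namespace Summit.CriticalPhenomena.PercolationContinuityZ3.Theorems

namespace SahiCoSunflowerCylinder

open Finset Function
open Literature.Combinatorics.Sahi2008
open Literature.Probability.LatticeModels (sahiE3 prodBernoulli)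
open Literature.Probability.Percolation.DecisionTree (ind ind_of_mem ind_of_not_mem ind_nonneg)

variable {ι : Type} [Fintype ι]

local notation3 (prettyPrint := false) "m⟦" p ", " X "⟧" => ex (bernoulliWeight p) (ind X)

/-! ### 1. Pointwise expansions of products of complement indicators -/

omit [Fintype ι] in
/-- `1_{Xᶜ} = 1 − 1_X`. [folklore] -/
theorem ind_compl_eq (X : Set (Set ι)) : ind Xᶜ = 1 - ind X := by
  funext ω
  simp only [Pi.sub_apply, Pi.one_apply]
  by_cases h : ω ∈ X <;> simp [ind_of_mem, ind_of_not_mem, h]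

omit [Fintype ι] in
/-- `1_{Xᶜ}·1_{Yᶜ} = 1 − 1_X − 1_Y + 1_{X∩Y}`. [folklore] -/
theorem ind_compl_mul_compl (X Y : Set (Set ι)) : ind Xᶜ * ind Yᶜ = 1 - ind X - ind Y + ind (X ∩ Y) := by
  funext ω
  simp only [Pi.mul_apply, Pi.sub_apply, Pi.add_apply, Pi.one_apply]
  by_cases h1 : ω ∈ X <;> by_cases h2 : ω ∈ Y <;> simp [ind_of_mem, ind_of_not_mem, h1, h2]

omit [Fintype ι] in
/-- `1_{Xᶜ}·1_{Yᶜ}·1_{Zᶜ} = 1 − Σ1 + Σ1_{∩₂} − 1_{∩₃}`. [folklore] -/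
theorem ind_compl_mul_compl_mul_compl (X Y Z : Set (Set ι)) :
    ind Xᶜ * ind Yᶜ * ind Zᶜ =
      1 - ind X - ind Y - ind Z + ind (X ∩ Y) + ind (X ∩ Z) + ind (Y ∩ Z) - ind (X ∩ Y ∩ Z) := by
  funext ω
  simp only [Pi.mul_apply, Pi.sub_apply, Pi.add_apply, Pi.one_apply]
  by_cases h1 : ω ∈ X <;> by_cases h2 : ω ∈ Y <;> by_cases h3 : ω ∈ Z <;> simp [ind_of_mem, ind_of_not_mem, h1, h2, h3]

/-! ### 2. The closed form on sunflower complements in the pairwise-intersection variables -/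

/-- **Sahi's functional on the complements of `(F₂F₃, F₁F₃, F₁F₂)`**, any three events, any product weight:
`E_3(1_{(F₂F₃)ᶜ}, 1_{(F₁F₃)ᶜ}, 1_{(F₁F₂)ᶜ}) = (1 + c)(a − v₁v₂) − (c − a)(v₁ + v₂)` with `a = m(F₁F₂F₃)`, `v₁ = m(F₂F₃)`, `v₂ = m(F₁F₃)`,
`c = m(F₁F₂)` (all pairwise intersections of the three members are the core `F₁F₂F₃`). [this work] -/
theorem sahiE_three_complPairInter_eq (p : ι → unitInterval) (F₁ F₂ F₃ : Set (Set ι)) :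
    sahiE (bernoulliWeight p) 3 ![ind (F₂ ∩ F₃)ᶜ, ind (F₁ ∩ F₃)ᶜ, ind (F₁ ∩ F₂)ᶜ] =
      (1 + m⟦p, F₁ ∩ F₂⟧) * (m⟦p, F₁ ∩ F₂ ∩ F₃⟧ - m⟦p, F₂ ∩ F₃⟧ * m⟦p, F₁ ∩ F₃⟧)
        - (m⟦p, F₁ ∩ F₂⟧ - m⟦p, F₁ ∩ F₂ ∩ F₃⟧) * (m⟦p, F₂ ∩ F₃⟧ + m⟦p, F₁ ∩ F₃⟧) := by
  set μ := bernoulliWeight p with hμ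
  have h1 : ∑ ω, μ ω = 1 := sum_bernoulliWeight p
  -- the pairwise / triple intersections of the three members
  have s12 : F₂ ∩ F₃ ∩ (F₁ ∩ F₃) = F₁ ∩ F₂ ∩ F₃ := Set.ext fun ω => by simp only [Set.mem_inter_iff]; tauto
  have s13 : F₂ ∩ F₃ ∩ (F₁ ∩ F₂) = F₁ ∩ F₂ ∩ F₃ := Set.ext fun ω => by simp only [Set.mem_inter_iff]; tauto
  have s23 : F₁ ∩ F₃ ∩ (F₁ ∩ F₂) = F₁ ∩ F₂ ∩ F₃ := Set.ext fun ω => by simp only [Set.mem_inter_iff]; tauto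
  have s123 : F₂ ∩ F₃ ∩ (F₁ ∩ F₃) ∩ (F₁ ∩ F₂) = F₁ ∩ F₂ ∩ F₃ := Set.ext fun ω => by simp only [Set.mem_inter_iff]; tauto
  rw [sahiE_three]
  have e1 : ex μ (ind (F₂ ∩ F₃)ᶜ) = 1 - ex μ (ind (F₂ ∩ F₃)) := by
    rw [ind_compl_eq, SahiCombDisjunct.ex_sub', ex_one h1]
  have e2 : ex μ (ind (F₁ ∩ F₃)ᶜ) = 1 - ex μ (ind (F₁ ∩ F₃)) := by
    rw [ind_compl_eq, SahiCombDisjunct.ex_sub', ex_one h1]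
  have e3 : ex μ (ind (F₁ ∩ F₂)ᶜ) = 1 - ex μ (ind (F₁ ∩ F₂)) := by
    rw [ind_compl_eq, SahiCombDisjunct.ex_sub', ex_one h1]
  have e12 : ex μ (ind (F₂ ∩ F₃)ᶜ * ind (F₁ ∩ F₃)ᶜ) = 1 - ex μ (ind (F₂ ∩ F₃)) - ex μ (ind (F₁ ∩ F₃)) + ex μ (ind (F₁ ∩ F₂ ∩ F₃)) := by
    rw [ind_compl_mul_compl, s12]; simp only [ex_add, SahiCombDisjunct.ex_sub', ex_one h1]
  have e13 : ex μ (ind (F₂ ∩ F₃)ᶜ * ind (F₁ ∩ F₂)ᶜ) = 1 - ex μ (ind (F₂ ∩ F₃)) - ex μ (ind (F₁ ∩ F₂)) + ex μ (ind (F₁ ∩ F₂ ∩ F₃)) := by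
    rw [ind_compl_mul_compl, s13]; simp only [ex_add, SahiCombDisjunct.ex_sub', ex_one h1]
  have e23 : ex μ (ind (F₁ ∩ F₃)ᶜ * ind (F₁ ∩ F₂)ᶜ) = 1 - ex μ (ind (F₁ ∩ F₃)) - ex μ (ind (F₁ ∩ F₂)) + ex μ (ind (F₁ ∩ F₂ ∩ F₃)) := by
    rw [ind_compl_mul_compl, s23]; simp only [ex_add, SahiCombDisjunct.ex_sub', ex_one h1]
  have e123 : ex μ (ind (F₂ ∩ F₃)ᶜ * ind (F₁ ∩ F₃)ᶜ * ind (F₁ ∩ F₂)ᶜ) =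
      1 - ex μ (ind (F₂ ∩ F₃)) - ex μ (ind (F₁ ∩ F₃)) - ex μ (ind (F₁ ∩ F₂)) + ex μ (ind (F₁ ∩ F₂ ∩ F₃))
        + ex μ (ind (F₁ ∩ F₂ ∩ F₃)) + ex μ (ind (F₁ ∩ F₂ ∩ F₃)) - ex μ (ind (F₁ ∩ F₂ ∩ F₃)) := by
    rw [ind_compl_mul_compl_mul_compl, s123, s12, s13, s23]; simp only [ex_add, SahiCombDisjunct.ex_sub', ex_one h1]
  rw [e1, e2, e3, e12, e13, e23, e123]
  ring

/-! ### 3. The arithmetic and the conditional-Harris criterion -/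

/-- The arithmetic step: from `v₁v₂ ≤ π·a` (conditional Harris inside `F₃`), `v₁ + v₂ ≤ π + a` (inclusion–exclusion inside `F₃`),
`π·c ≤ a` (Harris for `F₁F₂` and `F₃`), `a ≤ c`:  `(1+c)(a − v₁v₂) − (c−a)(v₁+v₂) ≥ (1+a)(a − πc) ≥ 0`. [this work] -/
theorem complPairInter_arith {a c v₁ v₂ π : ℝ} (hac : a ≤ c) (ha : 0 ≤ a) (hπc : π * c ≤ a)
    (hv : v₁ * v₂ ≤ π * a) (hs : v₁ + v₂ ≤ π + a) :
    0 ≤ (1 + c) * (a - v₁ * v₂) - (c - a) * (v₁ + v₂) := by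
  have h1 : (1 + c) * (π * a) ≥ (1 + c) * (v₁ * v₂) := mul_le_mul_of_nonneg_left hv (by linarith)
  have h2 : (c - a) * (v₁ + v₂) ≤ (c - a) * (π + a) := mul_le_mul_of_nonneg_left hs (by linarith)
  have key : (1 + c) * (a - π * a) - (c - a) * (π + a) = (1 + a) * (a - π * c) := by ring
  nlinarith [mul_nonneg (show (0:ℝ) ≤ 1 + a by linarith) (sub_nonneg.2 hπc)]

/-- **Criterion.**  For increasing `F₁, F₂, F₃` under a product weight, if `F₃` is conditionally positively correlating for the pair —
`m(F₂F₃)·m(F₁F₃) ≤ m(F₃)·m(F₁F₂F₃)` — then `0 ≤ E_3(1_{(F₂F₃)ᶜ}, 1_{(F₁F₃)ᶜ}, 1_{(F₁F₂)ᶜ})`. [this work] -/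
theorem sahiE_three_complPairInter_nonneg_of_condHarris (p : ι → unitInterval) {F₁ F₂ F₃ : Set (Set ι)} (h₁ : IsUpperSet F₁)
    (h₂ : IsUpperSet F₂) (h₃ : IsUpperSet F₃)
    (hcond : m⟦p, F₂ ∩ F₃⟧ * m⟦p, F₁ ∩ F₃⟧ ≤ m⟦p, F₃⟧ * m⟦p, F₁ ∩ F₂ ∩ F₃⟧) :
    0 ≤ sahiE (bernoulliWeight p) 3 ![ind (F₂ ∩ F₃)ᶜ, ind (F₁ ∩ F₃)ᶜ, ind (F₁ ∩ F₂)ᶜ] := by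
  rw [sahiE_three_complPairInter_eq]
  have hac : m⟦p, F₁ ∩ F₂ ∩ F₃⟧ ≤ m⟦p, F₁ ∩ F₂⟧ := Pointwise.ex_ind_le_of_subset p Set.inter_subset_left
  have ha : 0 ≤ m⟦p, F₁ ∩ F₂ ∩ F₃⟧ := ex_ind_nonneg' p _
  have hπc : m⟦p, F₃⟧ * m⟦p, F₁ ∩ F₂⟧ ≤ m⟦p, F₁ ∩ F₂ ∩ F₃⟧ := by
    have h := harris_ex_ind p h₃ (h₁.inter h₂)
    rwa [show F₃ ∩ (F₁ ∩ F₂) = F₁ ∩ F₂ ∩ F₃ from Set.inter_comm _ _] at h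
  -- inclusion–exclusion inside F₃: m(F₂F₃) + m(F₁F₃) = m(F₂F₃ ∪ F₁F₃) + m(F₁F₂F₃) ≤ m(F₃) + a
  have hs : m⟦p, F₂ ∩ F₃⟧ + m⟦p, F₁ ∩ F₃⟧ ≤ m⟦p, F₃⟧ + m⟦p, F₁ ∩ F₂ ∩ F₃⟧ := by
    have hU := SahiCoSunflowerOrCoordinate.ex_ind_union (bernoulliWeight p) (F₂ ∩ F₃) (F₁ ∩ F₃)
    have s12 : F₂ ∩ F₃ ∩ (F₁ ∩ F₃) = F₁ ∩ F₂ ∩ F₃ := Set.ext fun ω => by simp only [Set.mem_inter_iff]; tauto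
    rw [s12] at hU
    have hsub : F₂ ∩ F₃ ∪ F₁ ∩ F₃ ⊆ F₃ := Set.union_subset Set.inter_subset_right Set.inter_subset_right
    have hle := Pointwise.ex_ind_le_of_subset p hsub
    linarith
  exact complPairInter_arith hac ha hπc hcond hs

/-! ### 4. Cylinders -/

/-- **THEOREM (one generator a cylinder).**  For every finite cube, product weight `p`, set of coordinates `S` (`C = {ω | S ⊆ ω}`) and ALL
increasing `F₁, F₂`:  `0 ≤ E_3(μ_p; 1_{(F₂ ∩ C)ᶜ}, 1_{(F₁ ∩ C)ᶜ}, 1_{(F₁ ∩ F₂)ᶜ})` — Kahn's Conjecture 5 for the complements of the sunflower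
`(F₂ ∩ C, F₁ ∩ C, F₁ ∩ F₂)` (core `F₁ ∩ F₂ ∩ C`).  Blinovsky's conditional Harris on the cylinder supplies the criterion's hypothesis. [this work] -/
theorem sahiE_three_complPairInter_cylinder_nonneg (p : ι → unitInterval) (S : Set ι) {F₁ F₂ : Set (Set ι)} (h₁ : IsUpperSet F₁)
    (h₂ : IsUpperSet F₂) :
    0 ≤ sahiE (bernoulliWeight p) 3 ![ind (F₂ ∩ {ω : Set ι | S ⊆ ω})ᶜ, ind (F₁ ∩ {ω : Set ι | S ⊆ ω})ᶜ, ind (F₁ ∩ F₂)ᶜ] := by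
  refine sahiE_three_complPairInter_nonneg_of_condHarris p h₁ h₂ (isUpperSet_cylinder S) ?_
  have h := condHarris_ex_ind_cylinder p S h₂ h₁
  rwa [show F₂ ∩ F₁ ∩ {ω : Set ι | S ⊆ ω} = F₁ ∩ F₂ ∩ {ω : Set ι | S ⊆ ω} by rw [Set.inter_comm F₂ F₁]] at h

/-- The same in the tree's event functional `sahiE3 (prodBernoulli p)`: for increasing `G₁, G₂` and the cylinder `C = {ω | S ⊆ ω}`,
`0 ≤ E_3(μ_p; (G₂ ∩ C)ᶜ, (G₁ ∩ C)ᶜ, (G₁ ∩ G₂)ᶜ)` — the tree's open `(1 + a)(ab − e₂) ≥ e₃` (`sahiE3_compl_sunflower_eq`) on this stratum;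
gen 7's `sahiE3_compl_sunflower_coord_nonneg` is `S = {e}`. [this work] -/
theorem sahiE3_compl_sunflower_cylinder_nonneg (p : ι → unitInterval) (S : Set ι) {G₁ G₂ : Set (Set ι)} (h₁ : IsUpperSet G₁)
    (h₂ : IsUpperSet G₂) :
    0 ≤ sahiE3 (prodBernoulli p) (G₂ ∩ {ω : Set ι | S ⊆ ω})ᶜ (G₁ ∩ {ω : Set ι | S ⊆ ω})ᶜ (G₁ ∩ G₂)ᶜ := by
  rw [← sahiE_three_ind]
  exact sahiE_three_complPairInter_cylinder_nonneg p S h₁ h₂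

/-! ### 5. The reflected (co-sunflower) form: one generator an OR-clause -/

/-- **Co-sunflower with an OR-clause generator.**  For every product weight, every set of coordinates `S` and ALL increasing `A, B`:
`0 ≤ E_3(μ_p; B ∪ O_S, A ∪ O_S, A ∪ B)` with `O_S = {ω | ¬ S ⊆ ωᶜ}` (some coordinate of `S` is open; `O_{{e}} = {e ∈ ω}` is gen 7's
`sahiE_three_orCoord_nonneg`).  Proof: the reflection `ω ↦ ωᶜ`, `p ↦ 1 − p` (`sahiE3_eq_sahiE3_preimage_compl`) turns the triple into the
complements of `(G₂ ∩ C, G₁ ∩ C, G₁ ∩ G₂)` with `G₁ = (compl ⁻¹' A)ᶜ`, `G₂ = (compl ⁻¹' B)ᶜ` increasing and `C = {S ⊆ ω}`. [this work] -/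
theorem sahiE3_orCylinder_nonneg (p : ι → unitInterval) (S : Set ι) {A B : Set (Set ι)} (hA : IsUpperSet A) (hB : IsUpperSet B) :
    0 ≤ sahiE3 (prodBernoulli p) (B ∪ {ω : Set ι | ¬ S ⊆ ωᶜ}) (A ∪ {ω : Set ι | ¬ S ⊆ ωᶜ}) (A ∪ B) := by
  rw [Literature.Probability.LatticeModels.sahiE3_eq_sahiE3_preimage_compl p MeasurableSet.of_discrete MeasurableSet.of_discrete
    MeasurableSet.of_discrete]
  set G₁ : Set (Set ι) := (compl ⁻¹' A)ᶜ with hG₁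
  set G₂ : Set (Set ι) := (compl ⁻¹' B)ᶜ with hG₂
  have hG₁u : IsUpperSet G₁ := (Literature.Probability.LatticeModels.isLowerSet_preimage_compl hA).compl
  have hG₂u : IsUpperSet G₂ := (Literature.Probability.LatticeModels.isLowerSet_preimage_compl hB).compl
  have hO : compl ⁻¹' {ω : Set ι | ¬ S ⊆ ωᶜ} = {ω : Set ι | S ⊆ ω}ᶜ := by
    ext ω; simp
  have e1 : compl ⁻¹' (B ∪ {ω : Set ι | ¬ S ⊆ ωᶜ}) = (G₂ ∩ {ω : Set ι | S ⊆ ω})ᶜ := by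
    rw [Set.preimage_union, hO, hG₂, Set.compl_inter, compl_compl]
  have e2 : compl ⁻¹' (A ∪ {ω : Set ι | ¬ S ⊆ ωᶜ}) = (G₁ ∩ {ω : Set ι | S ⊆ ω})ᶜ := by
    rw [Set.preimage_union, hO, hG₁, Set.compl_inter, compl_compl]
  have e3 : compl ⁻¹' (A ∪ B) = (G₁ ∩ G₂)ᶜ := by
    rw [Set.preimage_union, hG₁, hG₂, Set.compl_inter, compl_compl, compl_compl]
  rw [e1, e2, e3]
  exact sahiE3_compl_sunflower_cylinder_nonneg _ S hG₁u hG₂u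

/-- The `sahiE`/`ind` form of the OR-clause theorem. [this work] -/
theorem sahiE_three_orCylinder_nonneg (p : ι → unitInterval) (S : Set ι) {A B : Set (Set ι)} (hA : IsUpperSet A)
    (hB : IsUpperSet B) :
    0 ≤ sahiE (bernoulliWeight p) 3 ![ind (B ∪ {ω : Set ι | ¬ S ⊆ ωᶜ}), ind (A ∪ {ω : Set ι | ¬ S ⊆ ωᶜ}), ind (A ∪ B)] := by
  rw [sahiE_three_ind]
  exact sahiE3_orCylinder_nonneg p S hA hB


/-! ### 6. (gen 8, second instalment) An INDEPENDENT third generator -/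

/-- **Independent-generator identity.**  If `F₃` is independent of `F₁`, `F₂` and `F₁ ∩ F₂` (three product identities; e.g. `F₃` lives on
coordinates not used by `F₁, F₂`), then with `g = m(F₃)`, `c = m(F₁F₂)`, `f_i = m(F_i)`:
`E_3(1_{(F₂F₃)ᶜ}, 1_{(F₁F₃)ᶜ}, 1_{(F₁F₂)ᶜ}) = g(1−g)·c·(1 + c − f₁ − f₂) + g²·(1 + c)·(c − f₁f₂)`. [this work] -/
theorem sahiE_three_complPairInter_indep_eq (p : ι → unitInterval) {F₁ F₂ F₃ : Set (Set ι)}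
    (hI12 : m⟦p, F₁ ∩ F₂ ∩ F₃⟧ = m⟦p, F₁ ∩ F₂⟧ * m⟦p, F₃⟧) (hI1 : m⟦p, F₁ ∩ F₃⟧ = m⟦p, F₁⟧ * m⟦p, F₃⟧)
    (hI2 : m⟦p, F₂ ∩ F₃⟧ = m⟦p, F₂⟧ * m⟦p, F₃⟧) :
    sahiE (bernoulliWeight p) 3 ![ind (F₂ ∩ F₃)ᶜ, ind (F₁ ∩ F₃)ᶜ, ind (F₁ ∩ F₂)ᶜ] =
      m⟦p, F₃⟧ * (1 - m⟦p, F₃⟧) * m⟦p, F₁ ∩ F₂⟧ * (1 + m⟦p, F₁ ∩ F₂⟧ - m⟦p, F₁⟧ - m⟦p, F₂⟧)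
        + m⟦p, F₃⟧ ^ 2 * (1 + m⟦p, F₁ ∩ F₂⟧) * (m⟦p, F₁ ∩ F₂⟧ - m⟦p, F₁⟧ * m⟦p, F₂⟧) := by
  rw [sahiE_three_complPairInter_eq, hI12, hI1, hI2]
  ring

/-- **THEOREM (independent third generator).**  For increasing `F₁, F₂` and ANY event `F₃` independent of `F₁, F₂, F₁ ∩ F₂`:
`0 ≤ E_3(μ_p; 1_{(F₂F₃)ᶜ}, 1_{(F₁F₃)ᶜ}, 1_{(F₁F₂)ᶜ})` — Kahn's Conjecture 5 for the complements of `(F₂F₃, F₁F₃, F₁F₂)`; in the co-sunflower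
cube picture: Sahi's `C_3` for `(G₂ ∪ G₃, G₁ ∪ G₃, G₁ ∪ G₂)` whenever `G₃` is independent of `G₁, G₂, G₁ ∪ G₂` (e.g. supported on its own
coordinates), `G₁, G₂` arbitrary increasing.  Both terms of the identity are nonnegative: `1 + c − f₁ − f₂ = m(F₁ᶜ ∩ F₂ᶜ) ≥ 0` and Harris `c ≥ f₁f₂`.
(The private-coordinate closure of `…SahiCoSunflowerPrivateCoordinate` iterated from `K = univ` is the special case `G₃` = a caterpillar
read-once formula; the two-level law proved there is NOT implied by this.) [this work] -/
theorem sahiE_three_complPairInter_indep_nonneg (p : ι → unitInterval) {F₁ F₂ F₃ : Set (Set ι)} (h₁ : IsUpperSet F₁)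
    (h₂ : IsUpperSet F₂) (hI12 : m⟦p, F₁ ∩ F₂ ∩ F₃⟧ = m⟦p, F₁ ∩ F₂⟧ * m⟦p, F₃⟧)
    (hI1 : m⟦p, F₁ ∩ F₃⟧ = m⟦p, F₁⟧ * m⟦p, F₃⟧) (hI2 : m⟦p, F₂ ∩ F₃⟧ = m⟦p, F₂⟧ * m⟦p, F₃⟧) :
    0 ≤ sahiE (bernoulliWeight p) 3 ![ind (F₂ ∩ F₃)ᶜ, ind (F₁ ∩ F₃)ᶜ, ind (F₁ ∩ F₂)ᶜ] := by
  rw [sahiE_three_complPairInter_indep_eq p hI12 hI1 hI2]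
  have hg0 : 0 ≤ m⟦p, F₃⟧ := ex_ind_nonneg' p _
  have hg1 : m⟦p, F₃⟧ ≤ 1 := ex_bernoulliWeight_ind_le_one p _
  have hc0 : 0 ≤ m⟦p, F₁ ∩ F₂⟧ := ex_ind_nonneg' p _
  have hH : m⟦p, F₁⟧ * m⟦p, F₂⟧ ≤ m⟦p, F₁ ∩ F₂⟧ := harris_ex_ind p h₁ h₂
  -- `1 + c − f₁ − f₂ = 1 − m(F₁ ∪ F₂) ≥ 0`
  have hn : 0 ≤ 1 + m⟦p, F₁ ∩ F₂⟧ - m⟦p, F₁⟧ - m⟦p, F₂⟧ := by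
    have hU := SahiCoSunflowerOrCoordinate.ex_ind_union (bernoulliWeight p) F₁ F₂
    have h1 := ex_bernoulliWeight_ind_le_one p (F₁ ∪ F₂)
    linarith
  have t1 : 0 ≤ m⟦p, F₃⟧ * (1 - m⟦p, F₃⟧) * m⟦p, F₁ ∩ F₂⟧ * (1 + m⟦p, F₁ ∩ F₂⟧ - m⟦p, F₁⟧ - m⟦p, F₂⟧) :=
    mul_nonneg (mul_nonneg (mul_nonneg hg0 (by linarith)) hc0) hn
  have t2 : 0 ≤ m⟦p, F₃⟧ ^ 2 * (1 + m⟦p, F₁ ∩ F₂⟧) * (m⟦p, F₁ ∩ F₂⟧ - m⟦p, F₁⟧ * m⟦p, F₂⟧) :=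
    mul_nonneg (mul_nonneg (pow_nonneg hg0 2) (by linarith)) (sub_nonneg.2 hH)
  exact add_nonneg t1 t2

end SahiCoSunflowerCylinder

end Summit.CriticalPhenomena.PercolationContinuityZ3.Theorems
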